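import Mathlib.Data.Fin.Tuple.Sort
import Mathlib.Algebra.Order.Rearrangement
import Summits.CriticalPhenomena.PercolationContinuityZ3.Theorems.PercNearOneGluingNoHeavyLowerTailSahiCombTriWAndMaj3

/-!
# AND with a claw block `claw k = {y ⊆ Fin k | k ≤ #y + 1}`, part 1: columns, sorted profiles, rearrangement

Support file of the one-cut programme (crux `NoHeavyLowerTail`, stmt-CriticalPhenomena-4575; unit `prim-lf-1` gen 49).
Toolkit for `…SahiCombTriWAndClaw` (the theorem `Cor_{P₁ ∧ claw k} ≥ 0` for every intersecting Kleitman shell `P₁` and every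
`k ≥ 3`), generalising part 1 of the `maj3` files (`…SahiCombTriWAndMaj3Cols`, the case `k = 3`: `claw 3 = maj3`).

* `claw k` (the top and the `k` co-atoms of `2^{Fin k}`; "at least `k − 1` of `k`"), `claw_eq`, `sum_claw`, `isUpperSet_claw`,
  `disjoint_claw_refl` (`k ≥ 3`), `claw_three`.
* Columns of a family `A ⊆ 2^{γ₁ ⊕ Fin k}` at `x ⊆ γ₁`: `clawU A x = [x⊔⊤ ∈ A] − [xᶜ⊔⊥ ∈ A]`, `clawW A i x = [x⊔(⊤−i) ∈ A] − [xᶜ⊔{i} ∈ A]`,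
  with values in `[-1,1]`, monotonicity, `w_i ≤ u` and the PAIR CONDITIONS `u(x)+u(x') ≥ 0`, `u(x)+w_i(x') ≥ 0`,
  `w_i(x)+w_j(x') ≥ 0 (i ≠ j)` for `x ∪ x' = ⊤`.
* SORTED PROFILE `clawS A x : Fin k → ℤ` = the co-atom columns at `x` in increasing order (`Tuple.sort`): increasing in the index,
  increasing in `x` (`clawS_mono`, a pigeonhole on the counting description `clawS_le_iff`), values in `[-1,1]`, `≤ u`, and the
  pair condition `s_j(x) + s_{j'}(x') ≥ 0` as soon as ONE of the two indices is not the minimum (`clawS_pair`).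
* `rearr_clawS`: the pointwise rearrangement inequality `Σ_i w_{A,i} w_{B,i} ≥ Σ_j s_{A,j} s_{B,k-1-j}` (Mathlib's rearrangement
  inequality for an antivarying pair).
* `corP_andProd_claw_eq`: `Cor_{P₁ ∧ claw k}(A,B) = Σ_{x∈P₁} [u_A u_B + Σ_i w_{A,i} w_{B,i}]`.
HONEST LABEL: complete proofs, std axioms; bookkeeping lemmas only. [this work]
-/

namespace Summit.CriticalPhenomena.PercolationContinuityZ3.Theorems

namespace FiveUpSet

open Finset

variable {γ₁ : Type} [DecidableEq γ₁] [Fintype γ₁] {k : ℕ}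

/-! ### The claw family -/

/-- `claw k = {y ⊆ Fin k | k ≤ #y + 1}`: the top and the `k` co-atoms ("at least `k − 1` of `k`"; `claw 3 = maj3`). [this work] -/
def claw (k : ℕ) : Finset (Finset (Fin k)) := univ.filter fun y => k ≤ y.card + 1

/-- Membership in `claw k`. [this work] -/
@[simp] theorem mem_claw {y : Finset (Fin k)} : y ∈ claw k ↔ k ≤ y.card + 1 := by simp [claw]

/-- The elements of `claw k`: the top and the co-atoms. [this work] -/
theorem claw_eq : claw k = insert univ (univ.image fun i : Fin k => univ.erase i) := by
  ext y
  rw [mem_claw, mem_insert, mem_image]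
  constructor
  · intro hy
    by_cases h : y = univ
    · exact Or.inl h
    · right
      have hlt : y.card < Fintype.card (Fin k) := lt_of_le_of_ne (card_le_univ y) (fun hc => h (eq_univ_of_card y hc))
      obtain ⟨i, -, hi⟩ := exists_mem_notMem_of_card_lt_card (s := y) (t := univ) (by rw [card_univ]; exact hlt)
      refine ⟨i, mem_univ i, ?_⟩
      symm
      apply eq_of_subset_of_card_le
      · intro a ha
        exact mem_erase.2 ⟨fun hai => hi (hai ▸ ha), mem_univ a⟩
      · rw [card_erase_of_mem (mem_univ i), card_univ, Fintype.card_fin]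
        omega
  · rintro (rfl | ⟨i, -, rfl⟩)
    · rw [card_univ, Fintype.card_fin]; omega
    · rw [card_erase_of_mem (mem_univ i), card_univ, Fintype.card_fin]; omega

/-- Summing over `claw k`: the top and the `k` co-atoms. [this work] -/
theorem sum_claw (f : Finset (Fin k) → ℤ) : ∑ y ∈ claw k, f y = f univ + ∑ i : Fin k, f (univ.erase i) := by
  rw [claw_eq, sum_insert, sum_image]
  · intro i _ j _ h
    exact (erase_inj _ (mem_univ i)).1 h
  · rw [mem_image]
    rintro ⟨i, -, hi⟩
    have : i ∈ univ.erase i := by rw [hi]; exact mem_univ i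
    exact (mem_erase.1 this).1 rfl

/-- `claw k` is an up-set. [this work] -/
theorem isUpperSet_claw : IsUpperSet (claw k : Set (Finset (Fin k))) := by
  intro y y' hyy' hy
  simp only [claw, coe_filter, mem_univ, true_and, Set.mem_setOf_eq] at hy ⊢
  exact hy.trans (by have := card_le_card hyy'; omega)

/-- `claw k` is antipode free for `k ≥ 3`. [this work] -/
theorem disjoint_claw_refl (hk : 3 ≤ k) : Disjoint (claw k) (refl (claw k)) := by
  rw [disjoint_left]
  intro y hy hy'
  rw [mem_refl, mem_claw] at hy'
  rw [mem_claw] at hy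
  have hc := card_compl y
  rw [Fintype.card_fin] at hc
  have := card_le_univ y
  rw [Fintype.card_fin] at this
  omega

/-- `claw 3 = maj3`. [this work] -/
theorem claw_three : claw 3 = maj3 := by
  ext y; rw [mem_claw]; unfold maj3; rw [mem_filter]; simp only [mem_univ, true_and]; omega

/-! ### The column functions of a family on the product cube `2^{γ₁ ⊕ Fin k}` -/

/-- Top column: `u_A(x) = [x ⊔ ⊤ ∈ A] − [xᶜ ⊔ ⊥ ∈ A]`. [this work] -/
def clawU (A : Finset (Finset (γ₁ ⊕ Fin k))) (x : Finset γ₁) : ℤ := sgnDiff A (refl A) (x.disjSum univ)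

/-- Co-atom column `i`: `w_{A,i}(x) = [x ⊔ (⊤−i) ∈ A] − [xᶜ ⊔ {i} ∈ A]`. [this work] -/
def clawW (A : Finset (Finset (γ₁ ⊕ Fin k))) (i : Fin k) (x : Finset γ₁) : ℤ := sgnDiff A (refl A) (x.disjSum (univ.erase i))

/-- The top column as a difference of indicators. [this work] -/
theorem clawU_eq (A : Finset (Finset (γ₁ ⊕ Fin k))) (x : Finset γ₁) :
    clawU A x = ind A (x.disjSum univ) - ind A (xᶜ.disjSum ∅) := by
  unfold clawU; rw [sgnDiff_refl_eq, compl_disjSum, compl_univ]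

/-- The co-atom column as a difference of indicators. [this work] -/
theorem clawW_eq (A : Finset (Finset (γ₁ ⊕ Fin k))) (i : Fin k) (x : Finset γ₁) :
    clawW A i x = ind A (x.disjSum (univ.erase i)) - ind A (xᶜ.disjSum {i}) := by
  unfold clawW; rw [sgnDiff_refl_eq, compl_disjSum]
  congr 2; ext j; simp

/-- If two sets cover `⊤`, the complement of the first lies in the second (local copy of the `AndJoint` lemma). [this work] -/
private theorem claw_compl_subset_of_cover {x x' : Finset γ₁} (h : x ∪ x' = univ) : xᶜ ⊆ x' := by
  intro a ha; rw [mem_compl] at ha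
  have := mem_univ a; rw [← h, mem_union] at this; tauto

section colfacts
variable {A : Finset (Finset (γ₁ ⊕ Fin k))} (hA : IsUpperSet (A : Set (Finset (γ₁ ⊕ Fin k))))
include hA

/-- The top column is increasing. [this work] -/
theorem clawU_mono {x x' : Finset γ₁} (h : x ⊆ x') : clawU A x ≤ clawU A x' := by
  rw [clawU_eq, clawU_eq]
  have h1 := ind_mono_pt hA (disjSum_mono h (le_refl (univ : Finset (Fin k))))
  have h2 := ind_mono_pt hA (disjSum_mono (compl_subset_compl.2 h) (le_refl (∅ : Finset (Fin k))))
  linarith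

/-- The co-atom columns are increasing. [this work] -/
theorem clawW_mono (i : Fin k) {x x' : Finset γ₁} (h : x ⊆ x') : clawW A i x ≤ clawW A i x' := by
  rw [clawW_eq, clawW_eq]
  have h1 := ind_mono_pt hA (disjSum_mono h (le_refl (univ.erase i : Finset (Fin k))))
  have h2 := ind_mono_pt hA (disjSum_mono (compl_subset_compl.2 h) (le_refl ({i} : Finset (Fin k))))
  linarith

/-- Each co-atom column is dominated by the top column. [this work] -/
theorem clawW_le_clawU (i : Fin k) (x : Finset γ₁) : clawW A i x ≤ clawU A x := by
  rw [clawW_eq, clawU_eq]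
  have h1 := ind_mono_pt hA (disjSum_mono (le_refl x) (erase_subset i (univ : Finset (Fin k))))
  have h2 := ind_mono_pt hA (disjSum_mono (le_refl xᶜ) (empty_subset ({i} : Finset (Fin k))))
  linarith

omit hA in
/-- Values of the top column lie in `[-1,1]`. [this work] -/
theorem clawU_bounds (x : Finset γ₁) : -1 ≤ clawU A x ∧ clawU A x ≤ 1 := by
  rw [clawU_eq]
  have h1 := ind_nonneg_le_one A (x.disjSum (univ : Finset (Fin k)))
  have h2 := ind_nonneg_le_one A (xᶜ.disjSum (∅ : Finset (Fin k)))
  constructor <;> linarith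

omit hA in
/-- Values of the co-atom columns lie in `[-1,1]`. [this work] -/
theorem clawW_bounds (i : Fin k) (x : Finset γ₁) : -1 ≤ clawW A i x ∧ clawW A i x ≤ 1 := by
  rw [clawW_eq]
  have h1 := ind_nonneg_le_one A (x.disjSum (univ.erase i : Finset (Fin k)))
  have h2 := ind_nonneg_le_one A (xᶜ.disjSum ({i} : Finset (Fin k)))
  constructor <;> linarith

/-- Pair condition for the top column: `x ∪ x' = ⊤ ⟹ u(x) + u(x') ≥ 0`. [this work] -/
theorem clawU_add_clawU_nonneg {x x' : Finset γ₁} (h : x ∪ x' = univ) : 0 ≤ clawU A x + clawU A x' := by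
  rw [clawU_eq, clawU_eq]
  have hc : xᶜ ⊆ x' := claw_compl_subset_of_cover h
  have hc' : x'ᶜ ⊆ x := claw_compl_subset_of_cover (by rw [union_comm]; exact h)
  have h1 := ind_mono_pt hA (disjSum_mono hc (empty_subset (univ : Finset (Fin k))))
  have h2 := ind_mono_pt hA (disjSum_mono hc' (empty_subset (univ : Finset (Fin k))))
  linarith

/-- Pair condition top/co-atom: `x ∪ x' = ⊤ ⟹ u(x) + w_i(x') ≥ 0`. [this work] -/
theorem clawU_add_clawW_nonneg (i : Fin k) {x x' : Finset γ₁} (h : x ∪ x' = univ) : 0 ≤ clawU A x + clawW A i x' := by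
  rw [clawU_eq, clawW_eq]
  have hc : xᶜ ⊆ x' := claw_compl_subset_of_cover h
  have hc' : x'ᶜ ⊆ x := claw_compl_subset_of_cover (by rw [union_comm]; exact h)
  have h1 := ind_mono_pt hA (disjSum_mono hc (empty_subset (univ.erase i : Finset (Fin k))))
  have h2 := ind_mono_pt hA (disjSum_mono hc' (subset_univ ({i} : Finset (Fin k))))
  linarith

/-- Pair condition between DIFFERENT co-atom columns: `x ∪ x' = ⊤, i ≠ j ⟹ w_i(x) + w_j(x') ≥ 0`. [this work] -/
theorem clawW_add_clawW_nonneg {i j : Fin k} (hij : i ≠ j) {x x' : Finset γ₁} (h : x ∪ x' = univ) :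
    0 ≤ clawW A i x + clawW A j x' := by
  rw [clawW_eq, clawW_eq]
  have hc : xᶜ ⊆ x' := claw_compl_subset_of_cover h
  have hc' : x'ᶜ ⊆ x := claw_compl_subset_of_cover (by rw [union_comm]; exact h)
  have hi : ({i} : Finset (Fin k)) ⊆ univ.erase j := by
    intro a ha; rw [mem_singleton] at ha; rw [ha]; exact mem_erase.2 ⟨hij, mem_univ i⟩
  have hj : ({j} : Finset (Fin k)) ⊆ univ.erase i := by
    intro a ha; rw [mem_singleton] at ha; rw [ha]; exact mem_erase.2 ⟨fun h => hij h.symm, mem_univ j⟩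
  have h1 := ind_mono_pt hA (disjSum_mono hc hi)
  have h2 := ind_mono_pt hA (disjSum_mono hc' hj)
  linarith

end colfacts

/-! ### The sorted profile of the co-atom columns -/

/-- The sorting permutation of the co-atom columns at `x` (increasing order). [this work] -/
def clawSort (A : Finset (Finset (γ₁ ⊕ Fin k))) (x : Finset γ₁) : Equiv.Perm (Fin k) := Tuple.sort fun i => clawW A i x

/-- The sorted profile: `s_{A,j}(x)` = the `(j+1)`-st smallest of the `k` co-atom columns at `x`. [this work] -/
def clawS (A : Finset (Finset (γ₁ ⊕ Fin k))) (x : Finset γ₁) (j : Fin k) : ℤ := clawW A (clawSort A x j) x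

/-- The sorted profile is the composition of the column tuple with the sorting permutation. [this work] -/
theorem clawS_eq_comp (A : Finset (Finset (γ₁ ⊕ Fin k))) (x : Finset γ₁) :
    clawS A x = (fun i => clawW A i x) ∘ (clawSort A x) := rfl

/-- The sorted profile is increasing in the index. [this work] -/
theorem clawS_monotone (A : Finset (Finset (γ₁ ⊕ Fin k))) (x : Finset γ₁) : Monotone (clawS A x) := by
  rw [clawS_eq_comp]; exact Tuple.monotone_sort _

/-- Values of the sorted profile lie in `[-1,1]`. [this work] -/
theorem clawS_bounds (A : Finset (Finset (γ₁ ⊕ Fin k))) (x : Finset γ₁) (j : Fin k) : -1 ≤ clawS A x j ∧ clawS A x j ≤ 1 :=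
  clawW_bounds _ x

/-- Values of the sorted profile are `-1`, `0` or `1`. [this work] -/
theorem clawS_val (A : Finset (Finset (γ₁ ⊕ Fin k))) (x : Finset γ₁) (j : Fin k) :
    clawS A x j = -1 ∨ clawS A x j = 0 ∨ clawS A x j = 1 := by
  have := clawS_bounds A x j; omega

/-- Counting description: `s_j(x) ≤ a` iff more than `j` co-atom columns are `≤ a` at `x`. [this work] -/
theorem clawS_le_iff (A : Finset (Finset (γ₁ ⊕ Fin k))) (x : Finset γ₁) (j : Fin k) (a : ℤ) :
    clawS A x j ≤ a ↔ (j : ℕ) < #{i | clawW A i x ≤ a} := by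
  rw [← Tuple.lt_card_le_iff_apply_le_of_monotone (clawS_monotone A x)]
  have hc : #{i | clawS A x i ≤ a} = #{i | clawW A i x ≤ a} := by
    apply card_equiv (clawSort A x)
    intro i
    simp only [mem_filter, mem_univ, true_and, clawS]
  rw [hc]

section sortedfacts
variable {A : Finset (Finset (γ₁ ⊕ Fin k))} (hA : IsUpperSet (A : Set (Finset (γ₁ ⊕ Fin k))))
include hA

/-- The sorted profile is dominated by the top column. [this work] -/
theorem clawS_le_clawU (x : Finset γ₁) (j : Fin k) : clawS A x j ≤ clawU A x := clawW_le_clawU hA _ x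

/-- **The sorted profile is increasing in `x`** (pigeonhole). [this work] -/
theorem clawS_mono {x x' : Finset γ₁} (h : x ⊆ x') (j : Fin k) : clawS A x j ≤ clawS A x' j := by
  rw [clawS_le_iff]
  have h' : (j : ℕ) < #{i | clawW A i x' ≤ clawS A x' j} := (clawS_le_iff A x' j _).1 le_rfl
  refine lt_of_lt_of_le h' (card_le_card ?_)
  intro i hi
  simp only [mem_filter, mem_univ, true_and] at hi ⊢
  exact (clawW_mono hA i h).trans hi

/-- **Pair condition for the sorted profile**: `x ∪ x' = ⊤ ⟹ s_j(x) + s_{j'}(x') ≥ 0` whenever `j'` is not the minimum index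
(the two values are realised by different co-atoms, or the minimum at `x'` steps in). [this work] -/
theorem clawS_pair {x x' : Finset γ₁} (h : x ∪ x' = univ) (j j' : Fin k) (hj' : 1 ≤ (j' : ℕ)) :
    0 ≤ clawS A x j + clawS A x' j' := by
  unfold clawS
  by_cases hab : clawSort A x j = clawSort A x' j'
  · let j₀ : Fin k := ⟨0, lt_of_le_of_lt (Nat.zero_le _) j'.isLt⟩
    have hne0 : j₀ ≠ j' := fun he => by have := congrArg Fin.val he; simp [j₀] at this; omega
    have hne : clawSort A x j ≠ clawSort A x' j₀ := by
      rw [hab]; exact fun he => hne0 ((clawSort A x').injective he).symm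
    have hp := clawW_add_clawW_nonneg hA hne h
    have hm : clawS A x' j₀ ≤ clawS A x' j' := clawS_monotone A x' (Fin.mk_le_of_le_val (Nat.zero_le _))
    unfold clawS at hm
    linarith
  · exact clawW_add_clawW_nonneg hA hab h

/-- Pair condition for ONE sorted column with a non-minimal index (a unit `K`-vector). [this work] -/
theorem clawS_pair_self {x x' : Finset γ₁} (h : x ∪ x' = univ) (j : Fin k) (hj : 1 ≤ (j : ℕ)) :
    0 ≤ clawS A x j + clawS A x' j := clawS_pair hA h j j hj

/-- Pair condition for the two-layer vector `s_j + s_{j'}` with `j'` non-minimal. [this work] -/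
theorem clawS_add_pair {x x' : Finset γ₁} (h : x ∪ x' = univ) (j j' : Fin k) (hj' : 1 ≤ (j' : ℕ)) :
    0 ≤ (clawS A x j + clawS A x j') + (clawS A x' j + clawS A x' j') := by
  have h1 := clawS_pair hA h j j' hj'
  have h2 := clawS_pair hA (by rw [union_comm]; exact h) j j' hj'
  linarith

/-- Pair condition for the two-layer vector `u + s_j`. [this work] -/
theorem clawU_add_clawS_pair {x x' : Finset γ₁} (h : x ∪ x' = univ) (j : Fin k) :
    0 ≤ (clawU A x + clawS A x j) + (clawU A x' + clawS A x' j) := by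
  have h1 := clawU_add_clawW_nonneg hA (clawSort A x' j) h
  have h2 := clawU_add_clawW_nonneg hA (clawSort A x j) (by rw [union_comm]; exact h)
  unfold clawS
  linarith

end sortedfacts

/-! ### Rearrangement and the row decomposition -/

/-- **Pointwise rearrangement**: `Σ_j s_{A,j}(x) s_{B,rev j}(x) ≤ Σ_i w_{A,i}(x) w_{B,i}(x)`. [this work] -/
theorem rearr_clawS (A B : Finset (Finset (γ₁ ⊕ Fin k))) (x : Finset γ₁) :
    ∑ j : Fin k, clawS A x j * clawS B x (Fin.rev j) ≤ ∑ i : Fin k, clawW A i x * clawW B i x := by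
  have hfg : Antivary (clawS A x) (fun j => clawS B x (Fin.rev j)) :=
    (clawS_monotone A x).antivary ((clawS_monotone B x).comp_antitone Fin.rev_anti)
  set σ := clawSort A x
  set τ := clawSort B x
  have h := hfg.sum_mul_le_sum_mul_comp_perm (σ := (σ.trans τ.symm).trans Fin.revPerm)
  refine h.trans (le_of_eq ?_)
  have e : ∀ j : Fin k, clawS A x j * clawS B x (Fin.rev (((σ.trans τ.symm).trans Fin.revPerm) j))
      = clawW A (σ j) x * clawW B (σ j) x := by
    intro j
    simp only [clawS, Equiv.trans_apply, Fin.revPerm_apply, Fin.rev_rev, Equiv.apply_symm_apply, σ, τ]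
  rw [Fintype.sum_congr _ _ e]
  exact Equiv.sum_comp σ (fun i => clawW A i x * clawW B i x)

/-- **Row decomposition**: `Cor_{P₁ ∧ claw k}(A,B) = Σ_{x∈P₁} [u_A(x)u_B(x) + Σ_i w_{A,i}(x)w_{B,i}(x)]`. [this work] -/
theorem corP_andProd_claw_eq (P₁ : Finset (Finset γ₁)) (A B : Finset (Finset (γ₁ ⊕ Fin k))) :
    corP (andProd P₁ (claw k)) A B = ∑ x ∈ P₁, (clawU A x * clawU B x + ∑ i : Fin k, clawW A i x * clawW B i x) := by
  rw [corP_eq_sum, andProd_eq_biUnion, sum_biUnion (pairwiseDisjoint_rows P₁ (claw k))]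
  refine sum_congr rfl fun x _ => ?_
  rw [sum_map, sum_claw]
  unfold clawU clawW
  simp only [rowEmb_apply]

end FiveUpSet

end Summit.CriticalPhenomena.PercolationContinuityZ3.Theorems
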